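import Literature.Topology.FourManifolds.SuspendedFamilyFoldChart
import HarnessLib

/-!
# Rank-one reduction: near a point with `dF ≠ 0` a map `ℝ⁴ → ℝ²` is `(t, f(t, x, y, z))`

Topic `Literature/Topology/FourManifolds`.  The first step of every local normal form for maps
from 4-manifolds to surfaces (folds, cusps, Lekili's moves): Lekili 2009, §3, p. 11 — *"If the
rank is `1`, then around `p` we can find local coordinates such that `F` is of the form
`(t, x, y, z) → (t, f(t, x, y, z))` by the inverse function theorem."*  This file PROVES the
statement for `C^∞` maps `F : ℝ⁴ → ℝ²` at any point `p` with `dF_p ≠ 0` (rank `≥ 1`): there are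
local diffeomorphisms `φ` of `ℝ⁴` at `p` (`φ p = 0`) and `ψ` of `ℝ²` with
`ψ (F q) = ((φ q)₀, f (φ q))` on the source of `φ`, for a function `f` smooth on the target of
`φ` — in the format of the chart clauses of `IsSimplifiedBrokenLefschetzFibration`
(cf. `HasIndefiniteFoldChart`, `SuspendedFamilyFoldChart.lean`).  The chart `φ` is
`q ↦ S(q - p) + (Fᵢ q - Fᵢ p - ℓ(q - p)) e₀` where `ℓ = d(Fᵢ)_p ≠ 0` and `S` is a linear
automorphism with first row `ℓ`; `ψ` is the affine map `w ↦ R(w - F p)` with `R` the identity or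
the coordinate swap.  Everything is proved with the tree's packaged inverse function theorem
(`Literature.Topology.FourManifolds.exists_openPartialHomeomorph_contDiffOn_symm`); no named fact is introduced.

* `exists_linearEquiv_apply_zero_eq` — a non-zero covector `ℓ` on `ℝ⁴` is the first row of a
  linear automorphism;
* `exists_rankOne_charts` — **the normal form `(t, f(t, x, y, z))`**.

## References

* Y. Lekili, *Wrinkled fibrations on near-symplectic manifolds*, Geom. Topol. 13 (2009)
  277–318 (arXiv:0712.2202), §3, p. 11. [Lekili2009]
* R. İ. Baykur, O. Saeki, *Simplifying indefinite fibrations on 4-manifolds*, arXiv:1705.11169,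
  §2.1. [BaykurSaeki2017]
-/

noncomputable section

open Set Function Filter
open scoped Topology ContDiff

namespace Literature.Topology.FourManifolds

/-- Local notation: `𝔼 n` is the model Euclidean space `EuclideanSpace ℝ (Fin n)`. -/
local notation "𝔼 " n:arg => EuclideanSpace ℝ (Fin n)

/-! ### Linear algebra: a non-zero covector is the first row of an automorphism -/

/-- A covector on `ℝ⁴` vanishing on the standard basis vanishes. [folklore] -/
theorem eq_zero_of_forall_apply_single_eq_zero {ℓ : 𝔼 4 →L[ℝ] ℝ}
    (h : ∀ j : Fin 4, ℓ (EuclideanSpace.single j (1 : ℝ)) = 0) : ℓ = 0 := by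
  ext v
  have hv : v = ∑ j : Fin 4, v j • EuclideanSpace.single j (1 : ℝ) := by
    conv_lhs => rw [← (EuclideanSpace.basisFun (Fin 4) ℝ).sum_repr v]
    simp
  rw [hv, map_sum]
  simp [h]

/-- **A non-zero covector `ℓ` on `ℝ⁴` is the first coordinate of a linear automorphism**: there
is `S : ℝ⁴ ≃L ℝ⁴` with `(S v)₀ = ℓ v` (complete `ℓ` by three of the four coordinate
functionals). [folklore] -/
theorem exists_linearEquiv_apply_zero_eq {ℓ : 𝔼 4 →L[ℝ] ℝ} (hℓ : ℓ ≠ 0) :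
    ∃ S : 𝔼 4 ≃L[ℝ] 𝔼 4, ∀ v, S v 0 = ℓ v := by
  -- a basis vector on which `ℓ` does not vanish
  obtain ⟨j, hj⟩ : ∃ j : Fin 4, ℓ (EuclideanSpace.single j (1 : ℝ)) ≠ 0 := by
    by_contra h
    push Not at h
    exact hℓ (eq_zero_of_forall_apply_single_eq_zero h)
  -- `S v = ℓ v • e₀ + Σₘ v_{j.succAbove m} • e_{m+1}`
  set S : 𝔼 4 →L[ℝ] 𝔼 4 := ℓ.smulRight (EuclideanSpace.single (0 : Fin 4) (1 : ℝ)) +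
    ∑ m : Fin 3, (EuclideanSpace.proj (j.succAbove m) : 𝔼 4 →L[ℝ] ℝ).smulRight
      (EuclideanSpace.single m.succ (1 : ℝ)) with hS
  have hS0 : ∀ v, S v 0 = ℓ v := fun v => by
    simp [hS, Fin.succ_ne_zero]
  have hSsucc : ∀ v (m : Fin 3), S v m.succ = v (j.succAbove m) := fun v m => by
    simp [hS, Pi.single_apply, Fin.succ_inj, mul_ite]
  have hinj : Injective S := by
    refine (injective_iff_map_eq_zero S).2 fun v hv => ?_
    have h0 : ℓ v = 0 := by rw [← hS0 v, hv]; rfl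
    have hm : ∀ m : Fin 3, v (j.succAbove m) = 0 := fun m => by rw [← hSsucc v m, hv]; rfl
    -- `v` is a multiple of `e_j`
    have hvj : v = v j • EuclideanSpace.single j (1 : ℝ) := by
      ext k
      rcases eq_or_ne k j with rfl | hk
      · simp
      · obtain ⟨m, rfl⟩ := Fin.exists_succAbove_eq hk
        simp [hm m, Fin.succAbove_ne]
    have hvj0 : v j = 0 := by
      have : v j * ℓ (EuclideanSpace.single j (1 : ℝ)) = 0 := by
        rw [hvj, map_smul, smul_eq_mul] at h0
        simpa using h0
      exact (mul_eq_zero.mp this).resolve_right hj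
    rw [hvj, hvj0, zero_smul]
  obtain ⟨T, hT⟩ := exists_continuousLinearEquiv_coe_eq hinj
  refine ⟨T, fun v => ?_⟩
  rw [← hS0 v, ← hT]
  rfl

/-- For each coordinate `i` of `ℝ²` there is a linear automorphism `R` of `ℝ²` moving it to the
first place: `(R w)₀ = wᵢ` (the identity or the swap). [folklore] -/
theorem exists_linearEquiv_two_apply_zero_eq (i : Fin 2) :
    ∃ R : 𝔼 2 ≃L[ℝ] 𝔼 2, ∀ w, R w 0 = w i := by
  fin_cases i
  · exact ⟨ContinuousLinearEquiv.refl ℝ (𝔼 2), fun w => rfl⟩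
  · -- the swap of the two coordinates (an involution)
    let sw : 𝔼 2 →L[ℝ] 𝔼 2 :=
      (EuclideanSpace.proj (1 : Fin 2) : 𝔼 2 →L[ℝ] ℝ).smulRight
          (EuclideanSpace.single (0 : Fin 2) (1 : ℝ)) +
        (EuclideanSpace.proj (0 : Fin 2) : 𝔼 2 →L[ℝ] ℝ).smulRight
          (EuclideanSpace.single (1 : Fin 2) (1 : ℝ))
    have hsw : ∀ w : 𝔼 2, sw w = WithLp.toLp 2 ![w 1, w 0] := fun w => by
      ext k
      fin_cases k <;> simp [sw]
    have hinv : ∀ w, sw (sw w) = w := fun w => by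
      rw [hsw, hsw]
      ext k
      fin_cases k <;> simp
    refine ⟨ContinuousLinearEquiv.equivOfInverse sw sw hinv hinv, fun w => ?_⟩
    rw [ContinuousLinearEquiv.equivOfInverse_apply, hsw]
    simp

/-! ### The normal form -/

/-- **Rank-one reduction** (Lekili 2009, §3, p. 11).  Let `F : ℝ⁴ → ℝ²` be `C^∞` and
`dF_p ≠ 0`.  Then there are local diffeomorphisms `φ` of `ℝ⁴` at `p` with `φ p = 0` and `ψ`
of `ℝ²` (`C^∞` with `C^∞` inverses on their sources/targets, `F (φ.source) ⊆ ψ.source`) and a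
function `f`, `C^∞` on `φ.target`, with `ψ (F q) = ((φ q)₀, f (φ q))` for all `q ∈ φ.source`:
in the coordinates `φ`, `ψ` the map `F` is `(t, x, y, z) ↦ (t, f(t, x, y, z))`.
[cite: Lekili2009, §3 p. 11] -/
theorem exists_rankOne_charts {F : 𝔼 4 → 𝔼 2} (hF : ContDiff ℝ ∞ F) {p : 𝔼 4}
    (hp : fderiv ℝ F p ≠ 0) :
    ∃ (φ : OpenPartialHomeomorph (𝔼 4) (𝔼 4)) (ψ : OpenPartialHomeomorph (𝔼 2) (𝔼 2))
      (f : 𝔼 4 → ℝ),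
      p ∈ φ.source ∧ φ p = 0 ∧ MapsTo F φ.source ψ.source ∧
      ContDiffOn ℝ ∞ φ φ.source ∧ ContDiffOn ℝ ∞ φ.symm φ.target ∧
      ContDiffOn ℝ ∞ ψ ψ.source ∧ ContDiffOn ℝ ∞ ψ.symm ψ.target ∧
      ContDiffOn ℝ ∞ f φ.target ∧
      ∀ q ∈ φ.source, ψ (F q) 0 = φ q 0 ∧ ψ (F q) 1 = f (φ q) := by
  have hFd : ∀ q, HasFDerivAt F (fderiv ℝ F q) q := fun q =>
    (hF.differentiable (by simp) q).hasFDerivAt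
  -- a component `i` of `F` with `d(Fᵢ)_p ≠ 0`
  obtain ⟨i, hi⟩ : ∃ i : Fin 2,
      (EuclideanSpace.proj i : 𝔼 2 →L[ℝ] ℝ).comp (fderiv ℝ F p) ≠ 0 := by
    by_contra h
    push Not at h
    apply hp
    ext v k
    simpa using congrArg (fun L : 𝔼 4 →L[ℝ] ℝ => L v) (h k)
  set ℓ : 𝔼 4 →L[ℝ] ℝ := (EuclideanSpace.proj i : 𝔼 2 →L[ℝ] ℝ).comp (fderiv ℝ F p) with hℓ
  obtain ⟨S, hS0⟩ := exists_linearEquiv_apply_zero_eq hi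
  obtain ⟨R, hR0⟩ := exists_linearEquiv_two_apply_zero_eq i
  -- the source chart `Φ q = S (q - p) + (Fᵢ q - Fᵢ p - ℓ (q - p)) • e₀`
  set e₀ : 𝔼 4 := EuclideanSpace.single (0 : Fin 4) (1 : ℝ) with he₀
  set Φ : 𝔼 4 → 𝔼 4 := fun q => S (q - p) + (F q i - F p i - ℓ (q - p)) • e₀ with hΦ_def
  have hFi : ContDiff ℝ ∞ fun q => F q i :=
    (EuclideanSpace.proj i : 𝔼 2 →L[ℝ] ℝ).contDiff.comp hF
  have hΦs : ContDiff ℝ ∞ Φ :=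
    (S.contDiff.comp (contDiff_id.sub contDiff_const)).add
      (((hFi.sub contDiff_const).sub (ℓ.contDiff.comp (contDiff_id.sub contDiff_const))).smul
        contDiff_const)
  have hΦd : HasFDerivAt Φ (S : 𝔼 4 →L[ℝ] 𝔼 4) p := by
    have h1 : HasFDerivAt (fun q : 𝔼 4 => S (q - p)) (S : 𝔼 4 →L[ℝ] 𝔼 4) p :=
      ((S : 𝔼 4 →L[ℝ] 𝔼 4).hasFDerivAt.comp p ((hasFDerivAt_id p).sub_const p)).congr_fderiv
        (by ext v; simp)
    have h2 : HasFDerivAt (fun q : 𝔼 4 => F q i) ℓ p :=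
      (EuclideanSpace.proj i : 𝔼 2 →L[ℝ] ℝ).hasFDerivAt.comp p (hFd p)
    have h3 : HasFDerivAt (fun q : 𝔼 4 => ℓ (q - p)) ℓ p :=
      (ℓ.hasFDerivAt.comp p ((hasFDerivAt_id p).sub_const p)).congr_fderiv (by ext v; simp)
    have h4 : HasFDerivAt (fun q : 𝔼 4 => (F q i - F p i - ℓ (q - p)) • e₀)
        ((0 : 𝔼 4 →L[ℝ] ℝ).smulRight e₀) p := by
      refine (((h2.sub_const (F p i)).sub h3).smul_const e₀).congr_fderiv ?_
      simp
    have h := h1.add h4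
    refine h.congr_fderiv ?_
    ext v
    simp
  obtain ⟨G, hGΦ, hpG, -, hGs, hGs'⟩ :=
    exists_openPartialHomeomorph_contDiffOn_symm isOpen_univ (mem_univ p) (m := ∞) (by simp)
      hΦs.contDiffOn S hΦd
  -- the target chart `Ψ w = R (w - F p)` (a global affine diffeomorphism)
  set Ψh : 𝔼 2 ≃ₜ 𝔼 2 := (Homeomorph.addRight (-F p)).trans R.toHomeomorph with hΨh
  have hΨapply : ∀ w, Ψh w = R (w - F p) := fun w => by
    simp [hΨh, sub_eq_add_neg]
  have hΨsymm_apply : ∀ w, Ψh.symm w = R.symm w + F p := fun w => by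
    apply Ψh.injective
    rw [Ψh.apply_symm_apply, hΨapply]
    simp
  have hΨs : ContDiff ℝ ∞ (Ψh : 𝔼 2 → 𝔼 2) := by
    rw [show (Ψh : 𝔼 2 → 𝔼 2) = fun w => R (w - F p) from funext hΨapply]
    exact R.contDiff.comp (contDiff_id.sub contDiff_const)
  have hΨs' : ContDiff ℝ ∞ (Ψh.symm : 𝔼 2 → 𝔼 2) := by
    rw [show (Ψh.symm : 𝔼 2 → 𝔼 2) = fun w => R.symm w + F p from funext hΨsymm_apply]
    exact R.symm.contDiff.add contDiff_const
  -- the fibre function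
  set f : 𝔼 4 → ℝ := fun y => R (F (G.symm y) - F p) 1 with hf_def
  have hfs : ContDiffOn ℝ ∞ f G.target := by
    have h1 : ContDiffOn ℝ ∞ (fun y => R (F (G.symm y) - F p)) G.target :=
      R.contDiff.comp_contDiffOn ((hF.comp_contDiffOn hGs').sub contDiffOn_const)
    exact (EuclideanSpace.proj (1 : Fin 2) : 𝔼 2 →L[ℝ] ℝ).contDiff.comp_contDiffOn h1
  refine ⟨G, Ψh.toOpenPartialHomeomorph, f, hpG, ?_, ?_, hGs, hGs',
    hΨs.contDiffOn, hΨs'.contDiffOn, hfs, ?_⟩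
  · rw [hGΦ]
    simp [hΦ_def]
  · intro q _
    simp
  · intro q hq
    have eψ : (Ψh.toOpenPartialHomeomorph : 𝔼 2 → 𝔼 2) (F q) = R (F q - F p) := hΨapply (F q)
    rw [eψ]
    constructor
    · rw [hR0, hGΦ]
      simp only [hΦ_def, PiLp.add_apply, PiLp.smul_apply, smul_eq_mul, PiLp.sub_apply, hS0]
      simp [he₀, hℓ]
    · simp only [hf_def]
      rw [G.left_inv hq]

end Literature.Topology.FourManifolds

end
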